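import Summits.CriticalPhenomena.Ising3DConformalLimit.Theses.CoerciveSharpness
import Summits.CriticalPhenomena.Ising3DConformalLimit.Theorems.WindowForcesU4.Negative.ModelBlind
import Summits.CriticalPhenomena.Ising3DConformalLimit.Theorems.WindowForcesU4.Negative.LoadBearing
import HarnessLib

/-!
# Disproof of `WindowForcesU4` (stmt-CriticalPhenomena-5505) — findings

Standing crux disprover `cdisprove-stmt-CriticalPhenomena-5505` (refuter lineage), cycle 1, 2026-08-17.
Crux (route CoerciveSharpness r5 = route LatticeSDPCertificates r3, `Iff.rfl`):
`WINDOW → ∀ ρ S, (ρ > 0 on (0,1]) → HasPointwiseScalingLimit (criticalCorr 3) ρ S →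
IsNondegenerateTwoPoint S → HasNontrivialU4 S`, WINDOW = item `WindowBelowHalf` (5507) verbatim
= `∃ ε c > 0, ∀ 1 ≤ m ≤ n, c (n/m)^{-(3/2-ε)} G(m e₁) ≤ G(n e₁)`, `G = criticalTwoPoint 3`.

**VERDICT: NO KILL, and none is available in this tree.** `¬ crux ⟺ WINDOW ∧ ¬ 0636`
(`IsingEuclidUpgradeR4NonGaussian`), i.e. WINDOW together with a non-degenerate GAUSSIAN pointwise limit
of critical Ising₃ — by the landed edge-Gaussianity chain such a limit has `Δ = 1/2`, `η = 0`
(`dimension_window_and_eta`, `twoPointPowerLawEta_of_nonGaussian'`). Both conjuncts are open physics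
consistent with every theorem of the tree and with print (Aizenman, arXiv:2509.02850 §4: Gaussianity of the
d = 3 limit "likely not" but unproved; Duminil-Copin ICM 2022 §6.6, §8.4; Panis 2023, p. 4 fn.;
DC–Panis 2025 Thm 1.5 gives only `η ≤ 1/2`). Typing is junk-free (see §0). What this file establishes
instead (all sorry-free unless marked NEAR-MISS; sections = the landed / proposed `Negative/` files):

* §0 TYPING AUDIT (comments): coercions, junk operators, quantifier order — nothing exploitable.
* §1 TIGHTNESS of the antecedent: `window_const_le_one` (`c ≤ 1`), `window_exponent_le_half` (`ε ≤ 1/2`,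
  from the infrared bound); both attained by the free-field impostor of §3 — WINDOW's room is `(0, 1/2]`.
* §2 LOAD-BEARING ANALYSIS: `windowForcesU4WithoutNondegeneracy_iff_not_window` — dropping
  non-degeneracy makes the crux EQUIVALENT to `¬ WINDOW` (witness: the null family, a genuine limit under
  `ρ δ = δ`); `windowForcesU4WithoutPositivity_of` — positivity of `ρ` is cosmetic; dropping WINDOW = crux
  0636 (open; no `false_without_window` exists); dropping `HasPointwiseScalingLimit` is absurd (S arbitrary).
* §3 MODEL-BLINDNESS (the lead's request "a `B_false_without_fourPoint` witness", LeadC2Status.md):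
  `WindowForcesU4For G` := the crux with `criticalCorr 3 ↦ G`; `windowForcesU4_iff_for_criticalCorr`;
  `not_windowForcesU4For_gffLattice` — FALSE for the generalised free field read on `ℤ³`, EVERY `Δ < 3/4`
  (WINDOW with equality, `ε = 3/2 - 2Δ`, `c = 1`; limit `gffFamily Δ`; `U₄ ≡ 0`);
  `not_windowForcesU4ForIsingLike` — false even for translation-invariant, pair-symmetric, odd-free,
  LATTICE-GAUSSIAN (`U₄^{ℤ³} ≡ 0`, Lebowitz-compatible), MMS-monotone families obeying the two-sided
  infrared-edge bounds `c‖x‖⁻¹ ≤ G₂ ≤ C‖x‖⁻¹` (`HasIsingEtaBounds 3 0`-shape) with a Möbius limit at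
  `Δ = 1/2` (witness `gffLattice (1/2)` = GFF₃ on `ℤ³`). So: no proof from two-point information +
  existence of the limit; the Ising MEASURE must enter through a quantitative four-point LOWER bound
  (`-U₄^{ℤ³} ≥ c S₂S₂` at macroscopic quadruples: 0636 Disproof §C `LatticeU4RatioPositive`; stub B of
  `Lines/birth.lean`; `stub_backboneFat` of `Lines/backbone_thinning_window.lean`).
* §4 NECESSITY: `not_isingExponentEta_zero_of_windowForcesU4` — crux + WINDOW + one non-degenerate limit
  `⊢ η ≠ 0`; `no_nondegenerate_limit_of_windowForcesU4_of_etaBounds_zero` — under `HasIsingEtaBounds 3 0`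
  (which forces WINDOW, `ε = 1/2`) the crux says Ising₃ has NO non-degenerate pointwise limit; with the
  route's existence item the crux carries `¬ HasIsingEtaBounds 3 0` (improving Fröhlich–Simon–Spencer along
  a subsequence — open since 1976). Cf. strategist `window_twoPointPowerLawEta_of_windowForcesU4`.
* §5 LINE AUDIT (picked line `backbone-thinning-window`, PICKED.md lead c3 18:12Z; previous line `birth`):
  no stub is cheaply refutable (details in the section docstring); formal kill threshold of the heart:
  `theta_lt_half_of_admissibleWindow` — `stub_backboneFat` needs every two-sided thinning exponent
  `θ < 1/2` (not merely `< ε`), since admissible `ε ≤ 1/2` (§1); MC j024752: `θ_bb = 0.23 ± 0.02`.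
* §6 NEAR-MISSES / not attempted (docstrings only, no theorem claimed).

Used from sibling disproofs (cited, re-proved tree-side where imported files do not carry them):
0636 `Cruxes/IsingEuclidUpgradeR4NonGaussian/Disproof.lean` §A.1 (`zeroFamily`), §A.3
(`iff_withoutPositivity`), §C; 13886 `Theorems/GaussianLimitNotScreened/Negative/ModelBlind*.lean`
(`ι`, `gffLattice`, `gffLattice_hasLimit`). `ledger negatives --problem CriticalPhenomena`: 0/11 relevant.
Literature: corpus vsearch/hybrid (Friedli–Velenik 2017 §3.10; Glimm–Jaffe 1985) — nothing beyond the
item's sources; galaxy search degraded (queued > 90 s) on 2026-08-17T18:5xZ.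

Tree side (this cycle): `Theorems/WindowForcesU4/Negative/ModelBlind.lean` (§3) LANDED p172644 (imported and
re-exported here); `Theorems/WindowForcesU4/Negative/LoadBearing.lean` (§1, §2, §4) LANDED p172907 (first submission p172697
bounced on an automatic fact-relocation of three zero-argument variant `def`s — lesson for Negative files: state
crux variants INLINE in theorem types). Both are imported and re-exported below; this work file adds §0, §5, §6.
-/

noncomputable section

namespace Summit.CriticalPhenomena.Ising3DConformalLimit.Cruxes.WindowForcesU4.Disproof

/-! ## §0 Typing audit (no finding)

* `criticalTwoPoint 3 (Pi.single 0 (m : ℤ))`: `m : ℕ` cast to `ℤ`; `m = 0` excluded by `1 ≤ m`; the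
  two-point function is a genuine infinite-volume limit (`criticalCorr_wellDefined_holds`, `d ≥ 3`), in
  `(0, 1]` on the axis (`criticalTwoPoint_axis_pos`, `criticalTwoPoint_le_one'`).
* `((n : ℝ) / m) ^ (-((3:ℝ)/2 - ε))`: real `rpow` of a positive base (`m ≥ 1`), no junk branch; `ε` is
  only required `> 0` but §1 shows `ε ≤ 1/2`, `c ≤ 1` automatically.
* Quantifier order `∃ ε c, ∀ m ≤ n` (uniform in the pair of scales) is the intended "all-scale" window;
  the weaker `∀ m ∃ …` or eventual forms would NOT give doubling at all scales (5508) — intended.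
* Conclusion side: `HasPointwiseScalingLimit` = locally uniform convergence on `NonCoincident` along
  `𝓝[>] 0` (full filter, not a sequence); `IsNondegenerateTwoPoint`/`HasNontrivialU4` read `S` on
  `NonCoincident` only, so junk values of `S` on diagonals are harmless (route note "junk-safe").
* `ρ > 0 on (0,1]` only: values of `ρ` off `(0,1]` never enter (`𝓝[>] 0`); cosmetic anyway (§2). -/

open Literature.Probability.LatticeModels Filter Topology
open Summit.CriticalPhenomena.Ising3DConformalLimit.Theses
open Summit.CriticalPhenomena.Ising3DConformalLimit.GaussianLimitNotScreenedNegative (gffLattice)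

/-! ## §1 Tightness of the window (LANDED: `Negative/LoadBearing.lean` §1, p172907) -/

/-- (re-export) **any WINDOW constant is `≤ 1`** (`m = n`). [folklore] -/
theorem window_const_le_one {ε c : ℝ}
    (hw : ∀ m n : ℕ, 1 ≤ m → m ≤ n →
      c * ((n : ℝ) / m) ^ (-((3:ℝ) / 2 - ε)) * criticalTwoPoint 3 (Pi.single 0 (m : ℤ)) ≤
        criticalTwoPoint 3 (Pi.single 0 (n : ℤ))) :
    c ≤ 1 := WindowForcesU4Negative.window_const_le_one hw

/-- (re-export) **any WINDOW exponent is `≤ 1/2`** (`m = 1` + the infrared bound `G(n e₁) ≤ C n⁻¹`);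
`ε = 1/2` is realised by GFF₃ on `ℤ³` (§3), so WINDOW's room is exactly `(0, 1/2]`. [folklore] -/
theorem window_exponent_le_half {ε c : ℝ} (hc : 0 < c)
    (hw : ∀ m n : ℕ, 1 ≤ m → m ≤ n →
      c * ((n : ℝ) / m) ^ (-((3:ℝ) / 2 - ε)) * criticalTwoPoint 3 (Pi.single 0 (m : ℤ)) ≤
        criticalTwoPoint 3 (Pi.single 0 (n : ℤ))) :
    ε ≤ 1 / 2 := WindowForcesU4Negative.window_exponent_le_half hc hw

/-! ## §2 Load-bearing analysis (LANDED: `Negative/LoadBearing.lean` §2–§3, p172907)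

* WINDOW dropped ⟹ crux 0636 `IsingEuclidUpgradeR4NonGaussian` (open; its disprover found no kill in two
  generations) — WINDOW is ENGINE-bearing (doubling 5508, top-heavy bubble 5509), not truth-bearing; no
  `false_without_window` can exist short of refuting 0636.
* non-degeneracy dropped ⟺ `¬ WINDOW`; lattice clause dropped ⟺ `¬ WINDOW`; positivity of `ρ` dropped ⟺ crux. -/

/-- (re-export) **dropping non-degeneracy turns the crux into `¬ WINDOW`** (zero family under `ρ δ = δ`). [folklore] -/
theorem withoutNondegeneracy_iff_not_window :
    (LatticeSDPCertificates.WindowBelowHalf → ∀ (ρ : ℝ → ℝ) (S : CorrFamily 3),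
      (∀ δ ∈ Set.Ioc (0:ℝ) 1, 0 < ρ δ) → HasPointwiseScalingLimit (criticalCorr 3) ρ S → HasNontrivialU4 S) ↔
    ¬ LatticeSDPCertificates.WindowBelowHalf :=
  WindowForcesU4Negative.windowForcesU4WithoutNondegeneracy_iff_not_window

/-- (re-export) **dropping the lattice clause turns the crux into `¬ WINDOW`** (unit Wick family). [folklore] -/
theorem withoutLimit_iff_not_window :
    (LatticeSDPCertificates.WindowBelowHalf → ∀ S : CorrFamily 3, IsNondegenerateTwoPoint S → HasNontrivialU4 S) ↔
    ¬ LatticeSDPCertificates.WindowBelowHalf :=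
  WindowForcesU4Negative.windowForcesU4WithoutLimit_iff_not_window

/-- (re-export) **positivity of `ρ` is cosmetic**. [folklore] -/
theorem iff_withoutPositivity : CoerciveSharpness.WindowForcesU4 ↔
    (LatticeSDPCertificates.WindowBelowHalf → ∀ (ρ : ℝ → ℝ) (S : CorrFamily 3),
      HasPointwiseScalingLimit (criticalCorr 3) ρ S → IsNondegenerateTwoPoint S → HasNontrivialU4 S) :=
  WindowForcesU4Negative.windowForcesU4_iff_withoutPositivity

/-! ## §3 Model-blindness (LANDED: `Theorems/WindowForcesU4/Negative/ModelBlind.lean`, p172644)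

The crux with `criticalCorr 3 ↦ G` (`WindowForcesU4For G`; `windowForcesU4_iff_for_criticalCorr`) is FALSE
for `G = gffLattice Δ`, every `Δ < 3/4` (`not_windowForcesU4For_gffLattice`), and false even in the Ising-like
sharpening `WindowForcesU4ForIsingLike` (translation-invariant, symmetric, odd-free, lattice-Gaussian,
MMS-monotone, `c‖x‖⁻¹ ≤ G₂ ≤ C‖x‖⁻¹`, Möbius limit at `Δ = 1/2`; witness `gffLattice (1/2)` = GFF₃ read on
`ℤ³`). Re-exported here for the readers of this work file. -/

/-- (re-export) the crux is its own model-blind form at `criticalCorr 3`. [folklore] -/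
theorem crux_iff_for_criticalCorr :
    CoerciveSharpness.WindowForcesU4 ↔ WindowForcesU4Negative.WindowForcesU4For (criticalCorr 3) :=
  WindowForcesU4Negative.windowForcesU4_iff_for_criticalCorr

/-- (re-export) **the model-blind crux is false**: witness `gffLattice Δ`, any `Δ < 3/4`. [folklore] -/
theorem not_forall_windowForcesU4For :
    ¬ ∀ G : LatticeCorrFamily 3, WindowForcesU4Negative.WindowForcesU4For G :=
  WindowForcesU4Negative.not_forall_windowForcesU4For

/-- (re-export) **… even for Ising-like two-point and algebraic structure** (GFF₃ on `ℤ³`). [folklore] -/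
theorem not_windowForcesU4ForIsingLike : ¬ WindowForcesU4Negative.WindowForcesU4ForIsingLike :=
  WindowForcesU4Negative.not_windowForcesU4ForIsingLike

/-- (re-export) the witness sits AT the edge of §1: the WINDOW inequality with `ε = 1/2`, `c = 1` holds with
EQUALITY for `gffLattice (1/2)` (`G₂(0, n e₁) = n⁻¹`). [folklore] -/
theorem gffLattice_half_window (m n : ℕ) (hm : 1 ≤ m) (hmn : m ≤ n) :
    (1:ℝ) * ((n : ℝ) / m) ^ (-((3:ℝ) / 2 - 1 / 2)) * gffLattice (1 / 2) 2 ![0, Pi.single 0 (m : ℤ)] ≤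
      gffLattice (1 / 2) 2 ![0, Pi.single 0 (n : ℤ)] := by
  have hm0 : (m : ℝ) ≠ 0 := by exact_mod_cast (by omega : m ≠ 0)
  have hn0 : (n : ℝ) ≠ 0 := by exact_mod_cast (by omega : n ≠ 0)
  rw [WindowForcesU4Negative.gffLattice_two_axis, WindowForcesU4Negative.gffLattice_two_axis,
    show (-((3:ℝ) / 2 - 1 / 2)) = (-1 : ℝ) by norm_num, show (-(2 * (1 / 2 : ℝ))) = (-1 : ℝ) by norm_num,
    Real.rpow_neg_one, Real.rpow_neg_one, Real.rpow_neg_one]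
  refine le_of_eq ?_
  field_simp

/-! ## §4 Necessity (LANDED: `Negative/LoadBearing.lean` §4, p172907) -/

/-- (re-export) **crux + WINDOW + ONE non-degenerate pointwise limit `⊢ η ≠ 0`** (log sense). [folklore] -/
theorem not_isingExponentEta_zero_of_crux {ρ : ℝ → ℝ} {S : CorrFamily 3}
    (h : CoerciveSharpness.WindowForcesU4) (hW : LatticeSDPCertificates.WindowBelowHalf)
    (hρ : ∀ δ ∈ Set.Ioc (0:ℝ) 1, 0 < ρ δ) (hlim : HasPointwiseScalingLimit (criticalCorr 3) ρ S)
    (hnd : IsNondegenerateTwoPoint S) : ¬ HasIsingExponentEta 3 0 :=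
  WindowForcesU4Negative.not_isingExponentEta_zero_of_windowForcesU4 h hW hρ hlim hnd

/-- (re-export) **under `HasIsingEtaBounds 3 0` (infrared bound sharp two-sidedly ⟹ WINDOW with `ε = 1/2`)
the crux says critical Ising₃ has NO non-degenerate pointwise limit** — while GFF₃ on `ℤ³` realises exactly
this two-point scenario WITH one (§3). [folklore] -/
theorem no_nondegenerate_limit_of_crux_of_etaBounds_zero {ρ : ℝ → ℝ} {S : CorrFamily 3}
    (h : CoerciveSharpness.WindowForcesU4) (h0 : HasIsingEtaBounds 3 0)
    (hρ : ∀ δ ∈ Set.Ioc (0:ℝ) 1, 0 < ρ δ) (hlim : HasPointwiseScalingLimit (criticalCorr 3) ρ S) :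
    ¬ IsNondegenerateTwoPoint S :=
  WindowForcesU4Negative.no_nondegenerate_limit_of_windowForcesU4_of_etaBounds_zero h h0 hρ hlim

/-- (re-export) **crux + existence of one non-degenerate limit `⊢ ¬ HasIsingEtaBounds 3 0`** — an
improvement of Fröhlich–Simon–Spencer along a subsequence, open since 1976: a lower bound on the price of
any proof. [folklore] -/
theorem not_etaBounds_zero_of_crux_of_limit (h : CoerciveSharpness.WindowForcesU4)
    (hex : ∃ (ρ : ℝ → ℝ) (S : CorrFamily 3), (∀ δ ∈ Set.Ioc (0:ℝ) 1, 0 < ρ δ) ∧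
      HasPointwiseScalingLimit (criticalCorr 3) ρ S ∧ IsNondegenerateTwoPoint S) :
    ¬ HasIsingEtaBounds 3 0 :=
  WindowForcesU4Negative.not_etaBounds_zero_of_windowForcesU4_of_limit h hex

/-! ## §5 Line audit — `Lines/backbone_thinning_window.lean` (picked by lead c3) and `Lines/birth.lean`

Cheap attacks run on each registered stub STATEMENT (degenerate instances, junk models, hypothesis
mutation); none bites:

* `stub_backboneExponent` (WINDOW → ∃ θ ≥ 0, c, C > 0, eventually in `L`, `n`: one-point LOWER and
  two-point UPPER backbone-density bounds with ONE exponent `θ`). Degenerate sites are excluded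
  (`L ≤ ‖u-a‖, ‖u-b‖, ‖a-b‖`, `u ≠ v`, `∀ᶠ L`); the ranking `rk` is existential per `(L,n)` (harmless);
  consistency of the two bounds at `‖u-v‖ = 1` only forces `2c ≤ 12·C·G(e₁)`-type relations between the
  free constants. An existence claim about critical Ising₃ exponents: neither provable nor refutable here.
* `stub_backboneFat` (WINDOW → ∀ two-sided `θ` → ∃ admissible window exponent `ε > θ`). Its conclusion
  can only hold with `θ < 1/2` (`theta_lt_half_of_admissibleWindow` below + §1): the formal kill
  threshold is `θ_bb ≥ 1/2` for SOME two-sided exponent of Stub 1's shape — but two-sidedness pins `θ`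
  (lower one-point vs upper two-point bounds pull in opposite directions), so no junk `θ` is available,
  and MC j024752 measures `θ_bb = 0.23 ± 0.02`. Not refutable cheaply; physically plausible.
* `stub_backbonePZ` (∀ θ < ε …: Paley–Zygmund): second-moment bookkeeping
  `E N ≍ L^{1-2θ-2η}`, `E N² ≲ L^{1-2θ-2η} Σ_{r ≤ L} r^{-2θ-2η}`-type sums are top-heavy exactly when
  `θ < ε` — the stub's hypothesis; sound. Provable-now per the lead; nothing to refute.
* `stub_mergeOfBackbonesMeet`: backbone ⊆ odd (open) bonds of its current, traces add, so a common vertex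
  joins `a` to `a'` in `n₁ + n₂`; deterministic inclusion + `Measure.mono`. Sound.
* `birth` stub B `stub_windowLatticeMeetingRobustness ≡ WindowBelowHalf → FarMergeIO`: crux-sized (its
  negation needs WINDOW ∧ "thin sourced clusters"), model-blind-false exactly like the crux (§3 witness has
  `merge`-analogue `≡ 0` with all two-point hypotheses intact) — informative, not a refutation.

Joint sufficiency: both compositions (`windowForcesU4_of_stubs`) are sorry-free and conclude the crux BY
NAME (strategist / skelvet records); no gap is smuggled by `WindowForcesU4_of`. -/

open Literature.Probability.LatticeModels in
/-- **Formal kill threshold of `stub_backboneFat`.** An "admissible window exponent above `θ`" exists only if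
`θ < 1/2` (§1 `window_exponent_le_half`). [folklore] -/
theorem theta_lt_half_of_admissibleWindow {θ : ℝ}
    (h : ∃ ε cW : ℝ, 0 < ε ∧ 0 < cW ∧
      (∀ m n : ℕ, 1 ≤ m → m ≤ n →
        cW * ((n : ℝ) / m) ^ (-((3:ℝ) / 2 - ε)) * criticalTwoPoint 3 (Pi.single 0 (m : ℤ)) ≤
          criticalTwoPoint 3 (Pi.single 0 (n : ℤ))) ∧ θ < ε) :
    θ < 1 / 2 := by
  obtain ⟨ε, cW, -, hcW, hw, hθ⟩ := h
  exact hθ.trans_le (window_exponent_le_half hcW hw)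

/-! ## §6 Near-misses and regimes not closed (no theorem claimed)

* STRICTLY NEGATIVE LATTICE `U₄` IMPOSTOR. Ising has `U₄^{ℤ³} < 0` strictly (random currents), the §3
  witnesses have `U₄^{ℤ³} ≡ 0`. Adding to `gffLattice (1/2) 4` a term `-exp(-Σ_{i<j}‖y_i - y_j‖₂)` keeps
  WINDOW and the limit (`ρ(δ)⁴ e^{-r/δ} = δ⁻² e^{-r/δ} → 0` locally uniformly off diagonals) and makes lattice
  `U₄ < 0` everywhere: strict negativity WITHOUT A RATE is not the missing lever either. Not formalised
  (routine `TendstoLocallyUniformlyOn` estimate); recorded for the next cycle if a line leans on mere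
  strictness.
* REFLECTION POSITIVITY of the witness: `gffLattice (1/2)` is the restriction to `ℤ³` of the massless free
  field of `ℝ³`, hence RP for lattice hyperplane reflections and all its Schwinger functions exist at all
  orders (`ModelBlindAllOrders.freeField` pattern). Not formalised here (no RP predicate on
  `LatticeCorrFamily` in the tree); it means even OS-type structure of the lattice family cannot replace the
  four-point lower bound.
* UNCONDITIONAL `¬ crux`: would need WINDOW (5507, open) AND a Gaussian non-degenerate Ising₃ limit — not
  constructible; no `--negative-modulo` filed because the natural `H` (= `WindowBelowHalf ∧ ¬ 0636`) is
  just `¬ crux` restated, not a construction. -/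

end Summit.CriticalPhenomena.Ising3DConformalLimit.Cruxes.WindowForcesU4.Disproof
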